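import Summits.BirchSwinnertonDyer.BirchSwinnertonDyer.Theorems.KimAtThreeDeepLowerOffStratumLevelLoweringBridge
import Summits.BirchSwinnertonDyer.Rank1Residual.Additive.X4TamDefectLevelLoweringFromWilesIrreducible
import Summits.BirchSwinnertonDyer.Rank1Residual.X4.LevelLoweredEigenDatum
import HarnessLib

/-!
# Route `KimAtThreeKolyvagin` (rung W2), crux `DeepLowerAtThreeOffKatoStratum` (item 19679), registered
# stub `stub_nonAdditive` on its covered rows with exactly one `3` in `∏ c_ℓ`: MULTIPLICITY ONE
# (Darmon–Diamond–Taylor Thm. 4.26) AND IHARA'S LEMMA (Ribet 1984 Thm. 4.1) BY NAME — the shape of cell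
# `b2b-bsdres`' TAM-DEFECT₂ END (`X4TamDefectLevelLoweringFromWilesIhara`, `p ≥ 5`, twisted) at `p = 3`,
# untwisted

Cell `bsd-addord`, seat `bsd-addord-w2-acc2` (PROGRAMME PART 1b, ACCEL-LIST row (2)), gen 2; item
`stmt-BirchSwinnertonDyer-19679`. Sequel to `KimAtThreeDeepLowerOffStratumLevelLoweringBridge` (p466316: the rows
from cell b2b-bsdres' certificate `LevelLowering.PlusSymbolLevelLowersOver`, and from its typed inputs (MO)
`ModPMultiplicityOne` + (OLD) `HasOldEigenPlusSymb`). Here the two typed inputs are fed EXACTLY as in b2b's line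
V44 / K50 (`Additive/X4TamDefectLevelLoweringFromWilesIrreducible`, `X4/LevelLoweredEigenDatum`):
* (MO) ⟸ the NAMED FACT `ModularForms.wiles1995_multiplicityOne` (DDT Thm. 4.26 = Ribet 1990 Thm. 5.2 (b) /
  Mazur–Ribet / Wiles 1995 Thm. 2.1, AS PRINTED over `J0 N`; at `p = 3` BOTH clauses are live on our rows:
  `3 ∤ N` good, or `3 ∥ N` with `U₃ = a₃ = ±1 ∉ 𝔪` multiplicative) + the per-row eigencharacter
  `χ₀ : 𝕋_ℤ(N) → k` (`χ₀(T_q) = a_q(E) mod 3`, `3 ∈ ker χ₀` maximal) with the fact's Galois package (a `ρ`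
  unramified outside `3N` with the Eichler–Shimura Frobenius polynomials, IRREDUCIBLE — per row `E[3] ⊗ k'`) +
  b2b's Eichler–Shimura dictionary node `EichlerShimuraModPMultiplicityOneOfIrreducible` (typed target; at
  `p = 3` its RIDER «a prime `q ≡ 2 (mod 3)` divides `N`» — no elliptic point of order `3` on `X₀(N)`,
  Ash–Stevens — is a GENUINE row condition here, since `9 ∤ N` on non-additive rows);
* (OLD) ⟸ the NAMED FACT `ModularForms.ribet1984_iharaLemma` (Ribet 1984 Thm. 4.1 / DDT Lemma 4.28 (a) +
  4.30 (b)) + b2b's ONE typed datum `HasLevelLoweredEigenDatum k M ℓ θ̄_E μ` (the level-`M = N/ℓ` eigen datum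
  of Ribet's level-lowered form at the Tamagawa-`3` prime `ℓ ∥ N`, split multiplicative, `a_ℓ(E) = 1`, so the
  stabilisation sign is `w = 1`; EXISTENCE of the datum = Ribet 1990 Thm. 1.1 / `diamond1995_refinedSerre` +
  `U`-stabilisation + its mod-`𝔭` symbol — b2b's node (T2′), not supplied), `μ` even;
  `(2 : k) ≠ 0` is automatic at `p = 3` (`𝔽₃ ↪ k`).
★★★ `stub_nonAdditive_covered_of_wiles1995_ihara` / `…_semistable_of_wiles1995_ihara`: the registered stub's
binders VERBATIM, then «ordinary if good, (ram) if multiplicative» (resp. `Semistable W₀`), `v₃(∏ c_ℓ) ≤ 1`,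
the level factorisation `N = M·ℓ` at the Tamagawa prime, and the inputs above ⟹ the 19679 row. NET: on
these rows the W2 route and b2b's TAM-DEFECT₂ line now carry the SAME residual shape — two named facts + two
typed dictionary nodes + per-row numerals. Theorems only; nothing asserted; the crux stays OPEN; BSD is not
proved by any of this. [cite: DarmonDiamondTaylor1995, Thm. 4.26 (§4.5, p. 134), Lemma 4.12 (p. 120) and Lemma 4.28 (a) (p. 135)]
[cite: Ribet1984ICM, Thm. 4.1] [cite: Ribet1990, Thm. 1.1 and Thm. 5.2 (b)] [cite: Diamond1995RefinedSerre, Thm. 1.1]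
[cite: AshStevens1986, §4] [cite: MazurTateTeitelbaum1986Invent, §I.4 (4.2) and §I.10]
[cite: Kim2022StructureSelmer, §1.5.1, Conj. 1.10 (PDF pp. 7–8)] [cite: Skinner2016PacificMC, Thm. C (§1)]
[cite: YanZhu2024MainConjNonCM, Thm. 4.15 (§4.6)] [cite: Mazur1978, Cor. 4.1] [cite: Miller2011LMS, Def. 1.1]
-/


set_option autoImplicit false
-- the Theorems namespace of a single-conjunct summit repeats the summit name by design (D-0017)
set_option linter.dupNamespace false

noncomputable section

open scoped MatrixGroups ModularForm Classical NumberField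

open CongruenceSubgroup WeierstrassCurve Polynomial IsDedekindDomain Literature.NumberTheory.EllipticCurves
  Literature.NumberTheory.EllipticCurves.ModularForms
  Literature.NumberTheory.EllipticCurves.Rank1Residual
  Literature.NumberTheory.EllipticCurves.Rank1Residual.Typed
  Literature.NumberTheory.EllipticCurves.Skinner2016
  Literature.NumberTheory.Automorphic
  Literature.NumberTheory.GaloisRepresentations Rat.HeightOneSpectrum
  Summit.BirchSwinnertonDyer.BirchSwinnertonDyer.Theorems.Rank1ResidualX1Defs

namespace Summit.BirchSwinnertonDyer.BirchSwinnertonDyer.Theorems.KimAtThreeDeepLowerOffStratumLevelLoweringFromPrint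

open Summit.BirchSwinnertonDyer.Rank1Residual
open Summit.BirchSwinnertonDyer.Rank1Residual.LevelLowering
open Summit.BirchSwinnertonDyer.BirchSwinnertonDyer.Theses.KimAtThreeKolyvagin
open Summit.BirchSwinnertonDyer.BirchSwinnertonDyer.Theorems.KimAtThreeDeepLowerOffStratumLevelLoweringBridge

section Tools

variable {k : Type*} [CommRing k] [Nontrivial k]

/-- `(2 : k) ≠ 0` in any non-trivial ring receiving `𝔽₃` (the hypothesis `h2` of b2b's (OLD)-from-Ihara
theorem, automatic at `p = 3`). [folklore] -/
theorem two_ne_zero_of_ringHom_zmod_three (ι : ZMod 3 →+* k) : (2 : k) ≠ 0 := by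
  intro h2
  have h3 : (3 : k) = 0 := by
    have h : ι (3 : ZMod 3) = (3 : k) := map_ofNat ι 3
    rw [show (3 : ZMod 3) = 0 from by decide, map_zero] at h
    exact h.symm
  have h1 : (1 : k) = 0 := by
    have h : (3 : k) - 2 = 1 := by norm_num
    rw [← h, h2, h3, sub_zero]
  exact one_ne_zero h1

omit [Nontrivial k] in
/-- At a Kolyvagin prime `q` of `(W, 3)` the level-`M` eigen datum at `(M, ℓ)` with `M·ℓ = N_E` gives the
`T_q`-relation with eigenvalue `a_q(E) mod 3` (`q ∤ N_E`, so `q ∤ M`, `q ≠ ℓ`, and `q` is good: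
`a_q(E) = L`-coefficient). [cite: MazurTateTeitelbaum1986Invent, §I.4 (4.2) and §I.10] -/
theorem heckeRel_of_isKolyvaginPrime_of_levelLoweredEigenDatum
    (W : WeierstrassCurve ℚ) [W.IsElliptic] [W.IsGloballyMinimal] (ι : ZMod 3 →+* k)
    {M ℓ : ℕ} [NeZero M] (hN : M * ℓ = W.conductorNorm ℤ) {μ : ℚ → k}
    (hdat : HasLevelLoweredEigenDatum k M ℓ (fun q ↦ ι ((W.LFunction q : ℤ) : ZMod 3)) μ)
    {q : ℕ} (hq : haveI : Fact (Nat.Prime 3) := ⟨Nat.prime_three⟩; Kato.IsKolyvaginPrime W 3 1 q) :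
    HeckeRel μ q (ι (W.frobeniusTrace q : ZMod 3)) := by
  haveI : Fact (Nat.Prime 3) := ⟨Nat.prime_three⟩
  haveI : Fact q.Prime := ⟨hq.prime⟩
  have hqN : ¬ q ∣ W.conductorNorm ℤ := hq.not_dvd_conductorNorm
  have hqM : ¬ q ∣ M := fun h ↦ hqN (hN ▸ h.mul_right ℓ)
  have hqℓ : q ≠ ℓ := fun h ↦ hqN (hN ▸ (h ▸ dvd_mul_left q M))
  have h := hdat.heckeRel_of_not_dvd hq.prime hqM hqℓ
  rwa [W.LFunction_apply_prime_eq_frobeniusTrace q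
    (hasGoodReductionAtPrime_of_not_dvd_conductorNorm W hqN)] at h

end Tools

/-! ### ★★★ The covered / semistable rows with `v₃(∏ c_ℓ) ≤ 1` from DDT Thm. 4.26 + Ihara BY NAME -/

section Rows

variable {k : Type*} [CommRing k] [Nontrivial k]

/-- ★★★ **`stub_nonAdditive` on its COVERED rows with `v₃(∏ c_ℓ) ≤ 1` — multiplicity one AND Ihara's lemma
BY NAME.** Binders of the registered stub VERBATIM (with the level written `M·ℓ`), then «ordinary if good,
(ram) if multiplicative», `v₃(∏ c_ℓ) ≤ 1`; the Tamagawa-`3` prime `ℓ ∥ N` (`ℓ ∤ M`, `a_ℓ(E) = 1`); a ring map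
`ι : 𝔽₃ → k`; (MO) FROM PRINT — `wiles1995_multiplicityOne` (`hW1`) + the eigencharacter `χ₀` of level `M·ℓ`
with DDT's hypotheses (`3 ∈ ker χ₀` maximal; `3 ∤ N` or `9 ∤ N ∧ U₃ ∉ ker χ₀`) and Galois package
(`k' ι' ρ hρ hρirr`) + b2b's dictionary node `hES` + the `p = 3` RIDER `hrider` (a prime `≡ 2 (mod 3)` divides
`N`); (OLD) FROM PRINT — `ribet1984_iharaLemma` (`hI`) + b2b's ONE typed datum `HasLevelLoweredEigenDatum k M ℓ
θ̄_E μ`, `μ` even. SIX further named facts (`hYZ hW20 hSk hmod hGZK hM`). The b2b composition verbatim: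
`(hW1 …).1` ⟹ `dim J₀(N)[𝔪] = 2` ⟹ (MO) by `hES`; `hasOldEigenPlusSymb_of_hasLevelLoweredEigenDatum` ⟹ (OLD)
with `w = 1`; then ★★ of the bridge. [cite: DarmonDiamondTaylor1995, Thm. 4.26 (§4.5, p. 134) and Lemma 4.28 (a) (p. 135)]
[cite: Ribet1984ICM, Thm. 4.1] [cite: Ribet1990, Thm. 1.1 and Thm. 5.2 (b)] [cite: AshStevens1986, §4]
[cite: YanZhu2024MainConjNonCM, Thm. 4.15 (§4.6)] [cite: Skinner2016PacificMC, Thm. C (§1)] [cite: Mazur1978, Cor. 4.1]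
[cite: Kim2022StructureSelmer, Conj. 1.10 (PDF p. 8)] -/
theorem stub_nonAdditive_covered_of_wiles1995_ihara
    (hYZ : YanZhu2026.thm415_padicValRat_bsd_rank_le_one)
    (hW20 : Wuthrich2014.lemma20_surjective_threeAdic_of_semistable)
    (hSk : Skinner2016.thmC_padicValRat_bsd_rank_zero)
    (hmod : hasEntireLFunction_rat) (hGZK : rank_eq_analyticRank_of_analyticRank_le_one)
    (hM : mazur_not_dvd_maninConstant_of_odd)
    (hW1 : wiles1995_multiplicityOne) (hI : ribet1984_iharaLemma) :
    ∀ (W₀ : WeierstrassCurve ℚ) [W₀.IsElliptic] [W₀.IsGloballyMinimal],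
      (∀ n : ℕ, W₀.HasSurjectiveModNGaloisRep (3 ^ n : ℕ)) → Finite W₀.sha →
      ∀ {M ℓ : ℕ} [NeZero M] [Fact ℓ.Prime] [NeZero (M * ℓ)], M * ℓ = W₀.conductorNorm ℤ →
      ∀ (D₀ : ModularParametrizationData W₀ (M * ℓ)),
        (∀ z ∈ D₀.L.lattice, ∃ w ∈ periodLattice D₀.f, z = D₀.c * w) →
        (∀ (W₂ : WeierstrassCurve ℚ) [W₂.IsElliptic] (D₂ : ModularParametrizationData W₂ (M * ℓ)),
          D₂.f = D₀.f → D₀.modularDegree ≤ D₂.modularDegree) →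
        (∀ r : ℚ, ratPlusSymbol D₀.f r ≠ 0 → 0 ≤ padicValRat 3 (ratPlusSymbol D₀.f r)) →
        kuriharaVanishingOrder W₀ 3 D₀.f = 0 →
        ¬ (haveI : Fact (Nat.Prime 3) := ⟨Nat.prime_three⟩; Addv W₀ 3) →
        (W₀.HasGoodReductionAtPrime 3 → ¬ (3 : ℤ) ∣ W₀.frobeniusTrace 3) →
        (W₀.HasMultiplicativeReductionAtPrime 3 →
          (haveI : Fact (Nat.Prime 3) := ⟨Nat.prime_three⟩; Ram W₀ 3)) →
        padicValNat 3 W₀.tamagawaProduct ≤ 1 →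
        -- the Tamagawa-`3` prime `ℓ ∥ N`, split multiplicative
        ¬ ℓ ∣ M → W₀.LFunction ℓ = 1 →
        ∀ (ι : ZMod 3 →+* k)
          -- (MO) from print: eigencharacter, DDT Thm. 4.26 hypotheses + Galois package, dictionary node, rider
          (χ₀ : HeckeRing0 (M * ℓ) 2 →+* k),
          (∀ (q : ℕ) (hq : q.Prime),
            χ₀ (HeckeRing0.T (M * ℓ) 2 q hq) = ι ((W₀.LFunction q : ℤ) : ZMod 3)) →
          ((3 : ℕ) : HeckeRing0 (M * ℓ) 2) ∈ RingHom.ker χ₀ → (RingHom.ker χ₀).IsMaximal →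
          (¬ 3 ∣ M * ℓ ∨ (¬ 3 ^ 2 ∣ M * ℓ ∧ HeckeRing0.T (M * ℓ) 2 3 Nat.prime_three ∉ RingHom.ker χ₀)) →
          ∀ (k' : Type) [Field k'] [TopologicalSpace k'] [DiscreteTopology k']
            (ι' : HeckeRing0 (M * ℓ) 2 ⧸ RingHom.ker χ₀ →+* k') (ρ : ModPGaloisRep ℚ k' 2),
            (∀ v : HeightOneSpectrum (𝓞 ℚ), ¬ ((primesEquiv v : Nat.Primes) : ℕ) ∣ M * ℓ * 3 →
              ρ.IsUnramifiedAt v ∧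
                ρ.HasFrobCharpolyAt v
                  (X ^ 2
                    - Polynomial.C (ι' (Ideal.Quotient.mk (RingHom.ker χ₀) (HeckeRing0.T (M * ℓ) 2
                        ((primesEquiv v : Nat.Primes) : ℕ) (primesEquiv v : Nat.Primes).2))) * X
                    + Polynomial.C (((primesEquiv v : Nat.Primes) : ℕ) : k'))) →
            FramedRep.IsIrreducible ρ →
            EichlerShimuraModPMultiplicityOneOfIrreducible (M * ℓ) 3 χ₀
              (fun q ↦ ι ((W₀.LFunction q : ℤ) : ZMod 3)) →
            (∃ q : ℕ, q.Prime ∧ q ∣ M * ℓ ∧ q % 3 = 2) →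
        -- (OLD) from print: the level-`M` eigen datum of Ribet's form, even
        ∀ (μ : ℚ → k), HasLevelLoweredEigenDatum k M ℓ (fun q ↦ ι ((W₀.LFunction q : ℤ) : ZMod 3)) μ →
          (∀ r : ℚ, μ (-r) = μ r) →
        ∃ d : ℕ, kuriharaPartialDeepInfty W₀ 3 D₀.f = d ∧
          kuriharaPartial W₀ 3 D₀.f 0 ≤
            ((padicValNat 3 (Nat.card (AddCommGroup.primaryComponent W₀.sha 3)) + d : ℕ) : ℕ∞) := by
  intro W₀ _ _ htower hfin M ℓ _ _ _ hN D₀ hopt hdeg hint hord hnA hordinary hram hv hℓM haℓ ι χ₀ hχ₀ hp𝔪 h𝔪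
    hpN k' _ _ _ ι' ρ hρ hρirr hES hrider μ hdat heven
  haveI hp3 : Fact (Nat.Prime 3) := ⟨Nat.prime_three⟩
  -- (MO): DDT Thm. 4.26 at `𝔪 = ker χ₀`, then the dictionary node with the `p = 3` rider
  have hfin2 := (hW1 (M * ℓ) 3 (by decide) (RingHom.ker χ₀) h𝔪 hp𝔪 k' ι' ρ hρ hρirr hpN).1
  have hMO : ModPMultiplicityOne k (M * ℓ) (fun q ↦ ι ((W₀.LFunction q : ℤ) : ZMod 3)) :=
    hES hχ₀ hp𝔪 h𝔪 hfin2 k' ι' ρ hρ hρirr (Or.inr (Or.inr hrider))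
  -- (OLD): the level-`M` datum + Ihara BY NAME, stabilisation sign `w = 1` (`a_ℓ = 1`)
  have hw : (1 : k) * (fun q ↦ ι ((W₀.LFunction q : ℤ) : ZMod 3)) ℓ = 1 := by
    simp only [haℓ, Int.cast_one, map_one, one_mul]
  have hOLD : HasOldEigenPlusSymb k (M * ℓ) (fun q ↦ ι ((W₀.LFunction q : ℤ) : ZMod 3)) ℓ 1 μ :=
    hasOldEigenPlusSymb_of_hasLevelLoweredEigenDatum hI (two_ne_zero_of_ringHom_zmod_three ι) hℓM hdat
      heven hw
  have hℓN : ℓ ∣ W₀.conductorNorm ℤ := hN ▸ dvd_mul_left ℓ M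
  exact stub_nonAdditive_covered_of_multiplicityOne hYZ hW20 hSk hmod hGZK hM W₀ htower hfin hN D₀ hopt
    hdeg hint hord hnA hordinary hram hv ι ℓ hℓN hMO μ hOLD hdat.isPeriodic
    (fun q hq ↦ heckeRel_of_isKolyvaginPrime_of_levelLoweredEigenDatum W₀ ι hN hdat hq)

/-- ★★★ **The same on the SEMISTABLE rows** (no (ram), no Yan–Zhu binder; `hSk hmod hGZK hM hBCDT hLL` + `hW1`
+ `hI` + the same (MO)/(OLD) print inputs and nodes). On a semistable row DDT Thm. 4.26 is live in BOTH clauses.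
[cite: DarmonDiamondTaylor1995, Thm. 4.26 (§4.5, p. 134) and Lemma 4.28 (a) (p. 135)] [cite: Ribet1984ICM, Thm. 4.1]
[cite: Ribet1990, Thm. 1.1 and Thm. 5.2 (b)] [cite: Skinner2016PacificMC, Thm. C (§1)] [cite: Mazur1978, Cor. 4.1]
[cite: Kim2022StructureSelmer, Conj. 1.10 (PDF p. 8)] -/
theorem stub_nonAdditive_semistable_of_wiles1995_ihara
    (hSk : Skinner2016.thmC_padicValRat_bsd_rank_zero)
    (hmod : hasEntireLFunction_rat) (hGZK : rank_eq_analyticRank_of_analyticRank_le_one)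
    (hM : mazur_not_dvd_maninConstant_of_odd)
    (hBCDT : exists_isNewformOf) (hLL : diamond1995_refinedSerre)
    (hW1 : wiles1995_multiplicityOne) (hI : ribet1984_iharaLemma) :
    ∀ (W₀ : WeierstrassCurve ℚ) [W₀.IsElliptic] [W₀.IsGloballyMinimal],
      (∀ n : ℕ, W₀.HasSurjectiveModNGaloisRep (3 ^ n : ℕ)) → Finite W₀.sha →
      ∀ {M ℓ : ℕ} [NeZero M] [Fact ℓ.Prime] [NeZero (M * ℓ)], M * ℓ = W₀.conductorNorm ℤ →
      ∀ (D₀ : ModularParametrizationData W₀ (M * ℓ)),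
        (∀ z ∈ D₀.L.lattice, ∃ w ∈ periodLattice D₀.f, z = D₀.c * w) →
        (∀ (W₂ : WeierstrassCurve ℚ) [W₂.IsElliptic] (D₂ : ModularParametrizationData W₂ (M * ℓ)),
          D₂.f = D₀.f → D₀.modularDegree ≤ D₂.modularDegree) →
        (∀ r : ℚ, ratPlusSymbol D₀.f r ≠ 0 → 0 ≤ padicValRat 3 (ratPlusSymbol D₀.f r)) →
        kuriharaVanishingOrder W₀ 3 D₀.f = 0 →
        ¬ (haveI : Fact (Nat.Prime 3) := ⟨Nat.prime_three⟩; Addv W₀ 3) →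
        Semistable W₀ →
        (W₀.HasGoodReductionAtPrime 3 → ¬ (3 : ℤ) ∣ W₀.frobeniusTrace 3) →
        padicValNat 3 W₀.tamagawaProduct ≤ 1 →
        ¬ ℓ ∣ M → W₀.LFunction ℓ = 1 →
        ∀ (ι : ZMod 3 →+* k)
          (χ₀ : HeckeRing0 (M * ℓ) 2 →+* k),
          (∀ (q : ℕ) (hq : q.Prime),
            χ₀ (HeckeRing0.T (M * ℓ) 2 q hq) = ι ((W₀.LFunction q : ℤ) : ZMod 3)) →
          ((3 : ℕ) : HeckeRing0 (M * ℓ) 2) ∈ RingHom.ker χ₀ → (RingHom.ker χ₀).IsMaximal →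
          (¬ 3 ∣ M * ℓ ∨ (¬ 3 ^ 2 ∣ M * ℓ ∧ HeckeRing0.T (M * ℓ) 2 3 Nat.prime_three ∉ RingHom.ker χ₀)) →
          ∀ (k' : Type) [Field k'] [TopologicalSpace k'] [DiscreteTopology k']
            (ι' : HeckeRing0 (M * ℓ) 2 ⧸ RingHom.ker χ₀ →+* k') (ρ : ModPGaloisRep ℚ k' 2),
            (∀ v : HeightOneSpectrum (𝓞 ℚ), ¬ ((primesEquiv v : Nat.Primes) : ℕ) ∣ M * ℓ * 3 →
              ρ.IsUnramifiedAt v ∧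
                ρ.HasFrobCharpolyAt v
                  (X ^ 2
                    - Polynomial.C (ι' (Ideal.Quotient.mk (RingHom.ker χ₀) (HeckeRing0.T (M * ℓ) 2
                        ((primesEquiv v : Nat.Primes) : ℕ) (primesEquiv v : Nat.Primes).2))) * X
                    + Polynomial.C (((primesEquiv v : Nat.Primes) : ℕ) : k'))) →
            FramedRep.IsIrreducible ρ →
            EichlerShimuraModPMultiplicityOneOfIrreducible (M * ℓ) 3 χ₀
              (fun q ↦ ι ((W₀.LFunction q : ℤ) : ZMod 3)) →
            (∃ q : ℕ, q.Prime ∧ q ∣ M * ℓ ∧ q % 3 = 2) →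
        ∀ (μ : ℚ → k), HasLevelLoweredEigenDatum k M ℓ (fun q ↦ ι ((W₀.LFunction q : ℤ) : ZMod 3)) μ →
          (∀ r : ℚ, μ (-r) = μ r) →
        ∃ d : ℕ, kuriharaPartialDeepInfty W₀ 3 D₀.f = d ∧
          kuriharaPartial W₀ 3 D₀.f 0 ≤
            ((padicValNat 3 (Nat.card (AddCommGroup.primaryComponent W₀.sha 3)) + d : ℕ) : ℕ∞) := by
  intro W₀ _ _ htower hfin M ℓ _ _ _ hN D₀ hopt hdeg hint hord hnA hsst hordinary hv hℓM haℓ ι χ₀ hχ₀ hp𝔪 h𝔪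
    hpN k' _ _ _ ι' ρ hρ hρirr hES hrider μ hdat heven
  haveI hp3 : Fact (Nat.Prime 3) := ⟨Nat.prime_three⟩
  have hfin2 := (hW1 (M * ℓ) 3 (by decide) (RingHom.ker χ₀) h𝔪 hp𝔪 k' ι' ρ hρ hρirr hpN).1
  have hMO : ModPMultiplicityOne k (M * ℓ) (fun q ↦ ι ((W₀.LFunction q : ℤ) : ZMod 3)) :=
    hES hχ₀ hp𝔪 h𝔪 hfin2 k' ι' ρ hρ hρirr (Or.inr (Or.inr hrider))
  have hw : (1 : k) * (fun q ↦ ι ((W₀.LFunction q : ℤ) : ZMod 3)) ℓ = 1 := by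
    simp only [haℓ, Int.cast_one, map_one, one_mul]
  have hOLD : HasOldEigenPlusSymb k (M * ℓ) (fun q ↦ ι ((W₀.LFunction q : ℤ) : ZMod 3)) ℓ 1 μ :=
    hasOldEigenPlusSymb_of_hasLevelLoweredEigenDatum hI (two_ne_zero_of_ringHom_zmod_three ι) hℓM hdat
      heven hw
  have hℓN : ℓ ∣ W₀.conductorNorm ℤ := hN ▸ dvd_mul_left ℓ M
  exact stub_nonAdditive_semistable_of_multiplicityOne hSk hmod hGZK hM hBCDT hLL W₀ htower hfin hN D₀
    hopt hdeg hint hord hnA hsst hordinary hv ι ℓ hℓN hMO μ hOLD hdat.isPeriodic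
    (fun q hq ↦ heckeRel_of_isKolyvaginPrime_of_levelLoweredEigenDatum W₀ ι hN hdat hq)

end Rows

end Summit.BirchSwinnertonDyer.BirchSwinnertonDyer.Theorems.KimAtThreeDeepLowerOffStratumLevelLoweringFromPrint

end
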